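import Literature.AlgebraicGeometry.Frobenioids.Categories
import Literature.NumberTheory.GaloisRepresentations.AbsGaloisGroup
import Literature.FieldTheory.Galois.RootOfUnityTwistedEndomorphism
import Mathlib.FieldTheory.Galois.Infinite
import Mathlib.NumberTheory.Cyclotomic.CyclotomicCharacter
import HarnessLib

/-!
# Relative slimness engine: the centraliser of `Gal(K̄/E)` in `G_K` is trivial
# ("infinitely divisible ⟹ torsion" Kummer engine, RELATIVE form for [AbsAnab] Thm 1.1.1 (ii))

S. Mochizuki, *The Absolute Anabelian Geometry of Hyperbolic Curves* (2004) [AbsAnab], Thm 1.1.1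
(ii) p. 6: for a number field `F` and a nonarchimedean prime `𝔭` of `F̄`, the inclusion of the
decomposition group `G_𝔭 ↪ G_F` is *relatively slim* (the centraliser in `G_F` of every open
subgroup of `G_𝔭` is trivial; typed as `galoisNF_decomposition_relativelySlim`, conditional
discharge by abc-iut-L4-t11 from commensurable terminality + local slimness).  This proof-only file
is the RELATIVE form of the class-field-theory-free Kummer engine of
`SlimOfDivisibleTorsionProofs.lean` (there: `E` finite over `K`, giving slimness of `G_K`): for ANY
intermediate field `E` of `K̄/K` (`char K = 0`) and `σ ∈ Gal(K̄/K)` commuting with `Gal(K̄/E)`,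
`σ = 1` as soon as, for every `x ∈ K̄`, the field `M = E·K(x)` (a finite extension of `E`) admits
(1) a homomorphism `M^× → ℤ` not killing a fixed `a₀ ∈ K^×` and (2) "every infinitely divisible unit
of `M` has finite order" (`AlgEquiv.eq_one_of_commute_fixingSubgroup_of_divisible_isOfFinOrder`;
subgroup form `centralizer_fixingSubgroup_eq_bot_of_divisible_isOfFinOrder`).  With `E` a finite
extension of the decomposition field of `𝔭` these inputs are statements about finite extensions of
a henselian discretely valued field; the engine is the reduction of Thm 1.1.1 (ii) to them.
Proof: Kummer classes `σ(a) = βⁿ a^m` on `M^×`, the homomorphism pins `m ≡ 1 (mod N)`, so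
`σ(x)/x ∈ ⋂_N (M^×)^N` is a root of unity, and the cyclotomic additive trick
(`Literature.FieldTheory.Galois.eq_self_of_forall_pow_eq`) gives `σ = 1`.  Proof-only, no
definitions. [cite: MochizukiAbsAnab2004, Thm 1.1.1 (ii) p.6]
-/

noncomputable section

open scoped Classical IntermediateField

namespace Literature.AnabelianGeometry.AbsoluteAnabelian

open Field IntermediateField
open Literature.AlgebraicGeometry.Frobenioids (IsSlimGroup)

universe u

section General

variable {K : Type u} [Field K] [CharZero K]

/-- KUMMER STEP: for `σ ∈ Gal(K̄/K)` commuting with `Gal(K̄/M)` and `n ≥ 1`, there is `m ∈ ℤ`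
with `σ(a) = βⁿ · a^m`, `β ∈ M^×`, for all `a ∈ M^×`. [folklore] -/
private theorem exists_int_forall_sigma_eq_rel (M : IntermediateField K (AlgebraicClosure K))
    (σ : AlgebraicClosure K ≃ₐ[K] AlgebraicClosure K)
    (hσ : ∀ τ ∈ M.fixingSubgroup, ∀ y : AlgebraicClosure K, τ (σ y) = σ (τ y))
    {n : ℕ} (hn : 0 < n) :
    ∃ m : ℤ, ∀ a : AlgebraicClosure K, a ∈ M → a ≠ 0 →
      ∃ β : AlgebraicClosure K, β ∈ M ∧ β ≠ 0 ∧ σ a = β ^ n * a ^ m := by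
  haveI : NeZero n := ⟨hn.ne'⟩
  obtain ⟨m, hm⟩ := rootsOfUnity.integer_power_of_ringEquiv n (σ : AlgebraicClosure K ≃+* _)
  refine ⟨m, fun a haM ha0 => ?_⟩
  obtain ⟨α, hα⟩ := IsAlgClosed.exists_pow_nat_eq a hn
  have hα0 : α ≠ 0 := by
    rintro rfl
    rw [zero_pow hn.ne'] at hα
    exact ha0 hα.symm
  set β : AlgebraicClosure K := σ α / α ^ m with hβdef
  have hβ0 : β ≠ 0 := by
    rw [hβdef]
    exact div_ne_zero ((map_ne_zero σ).mpr hα0) (zpow_ne_zero _ hα0)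
  have hβM : β ∈ M := by
    rw [← InfiniteGalois.fixedField_fixingSubgroup M, IntermediateField.mem_fixedField_iff]
    intro τ hτ
    have hτa : τ a = a := (IntermediateField.mem_fixingSubgroup_iff _ _).mp hτ a haM
    have hζn : (τ α / α) ^ n = 1 := by
      rw [div_pow, ← map_pow, hα, hτa, div_self ha0]
    have hζ0 : τ α / α ≠ 0 := div_ne_zero ((map_ne_zero τ).mpr hα0) hα0
    set ζu : (AlgebraicClosure K)ˣ := Units.mk0 (τ α / α) hζ0 with hζu
    have hζmem : ζu ∈ rootsOfUnity n (AlgebraicClosure K) := by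
      rw [mem_rootsOfUnity]
      exact Units.ext (by simp [hζu, hζn])
    have hσζ : σ (τ α / α) = (τ α / α) ^ m := by
      have := hm ⟨ζu, hζmem⟩
      simpa [hζu, Units.val_zpow_eq_zpow_val] using this
    have hτα : τ α = (τ α / α) * α := by rw [div_mul_cancel₀ _ hα0]
    rw [hβdef, map_div₀, map_zpow₀, hσ τ hτ α, hτα, map_mul, hσζ, mul_zpow]
    field_simp
  refine ⟨β, hβM, hβ0, ?_⟩
  have hσα : σ α = β * α ^ m := by rw [hβdef, div_mul_cancel₀ _ (zpow_ne_zero _ hα0)]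
  calc σ a = σ (α ^ n) := by rw [hα]
    _ = (β * α ^ m) ^ n := by rw [map_pow, hσα]
    _ = β ^ n * (α ^ n) ^ m := by rw [mul_pow, ← zpow_natCast (α ^ m), ← zpow_mul, mul_comm m,
        zpow_mul, zpow_natCast]
    _ = β ^ n * a ^ m := by rw [hα]

end General

/-- **Relative slimness engine.**  Let `char K = 0`, `a₀ ∈ K^×`, `E` an intermediate field of
`K̄/K`, and `σ ∈ Gal(K̄/K)` commuting with every element of `Gal(K̄/E)`.  Suppose that for every
`x ∈ K̄`, writing `M = E ⊔ K(x)`: (1) there is a homomorphism `v : M^× → ℤ` with `v(a₀) ≠ 0`;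
(2) every unit of `M` that is an `N`-th power for all `N ≥ 1` has finite order.  Then `σ = 1`.
[cite: MochizukiAbsAnab2004, Thm 1.1.1 (ii) p.6] -/
theorem AlgEquiv.eq_one_of_commute_fixingSubgroup_of_divisible_isOfFinOrder {K : Type u} [Field K]
    [CharZero K] (a₀ : K) (ha₀ : a₀ ≠ 0) (E : IntermediateField K (AlgebraicClosure K))
    (σ : AlgebraicClosure K ≃ₐ[K] AlgebraicClosure K)
    (hσ : ∀ τ ∈ E.fixingSubgroup, ∀ y : AlgebraicClosure K, τ (σ y) = σ (τ y))
    (hv : ∀ x : AlgebraicClosure K,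
      ∃ v : ((E ⊔ K⟮x⟯ : IntermediateField K (AlgebraicClosure K)) : Type u)ˣ →* Multiplicative ℤ,
        v (Units.mk0 (algebraMap K (E ⊔ K⟮x⟯ : IntermediateField K (AlgebraicClosure K)) a₀)
          ((map_ne_zero _).mpr ha₀)) ≠ 1)
    (hD : ∀ x : AlgebraicClosure K,
      ∀ u : ((E ⊔ K⟮x⟯ : IntermediateField K (AlgebraicClosure K)) : Type u)ˣ,
        (∀ N : ℕ, 0 < N →
          ∃ b : ((E ⊔ K⟮x⟯ : IntermediateField K (AlgebraicClosure K)) : Type u)ˣ, b ^ N = u) →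
        IsOfFinOrder u) :
    σ = 1 := by
  haveI : Algebra.IsAlgebraic K (AlgebraicClosure K) := AlgebraicClosure.isAlgebraic K
  set σ' := σ with hσ'
  suffices hfix : ∀ x : AlgebraicClosure K, σ' x = x from AlgEquiv.ext hfix
  -- it suffices to show that `σ' x / x` is a root of unity for every `x ≠ 0`
  refine Literature.FieldTheory.Galois.eq_self_of_forall_pow_eq (σ' : AlgebraicClosure K →+* _)
    fun x hx0 => ?_
  change ∃ n : ℕ, 0 < n ∧ σ' x ^ n = x ^ n
  set M : IntermediateField K (AlgebraicClosure K) := E ⊔ K⟮x⟯ with hMdef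
  have hxM : x ∈ M := (le_sup_right : K⟮x⟯ ≤ M) (IntermediateField.mem_adjoin_simple_self K x)
  have hcomm : ∀ τ ∈ M.fixingSubgroup, ∀ y : AlgebraicClosure K, τ (σ' y) = σ' (τ y) := by
    intro τ hτ y
    have hτE : τ ∈ E.fixingSubgroup := by
      rw [IntermediateField.mem_fixingSubgroup_iff] at hτ ⊢
      exact fun z hz => hτ z ((le_sup_left : E ≤ M) hz)
    exact hσ τ hτE y
  have hσxM : σ' x ∈ M := by
    rw [← InfiniteGalois.fixedField_fixingSubgroup M, IntermediateField.mem_fixedField_iff]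
    intro τ hτ
    rw [hcomm τ hτ x, (IntermediateField.mem_fixingSubgroup_iff _ _).mp hτ x hxM]
  -- the homomorphism `v : M^× → ℤ` with `v(a₀) ≠ 0`
  obtain ⟨v, hva₀⟩ := hv x
  let ν : (M : Type u)ˣ → ℤ := fun y => Multiplicative.toAdd (v y)
  have hνmul : ∀ y z : (M : Type u)ˣ, ν (y * z) = ν y + ν z := fun y z => by
    simp only [ν, map_mul, toAdd_mul]
  have hνpow : ∀ (y : (M : Type u)ˣ) (k : ℕ), ν (y ^ k) = k * ν y := fun y k => by
    simp only [ν, map_pow, toAdd_pow, nsmul_eq_mul]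
  have hνzpow : ∀ (y : (M : Type u)ˣ) (k : ℤ), ν (y ^ k) = k * ν y := fun y k => by
    simp only [ν, map_zpow, toAdd_zpow, zsmul_eq_mul, Int.cast_id]
  set aM : M := algebraMap K M a₀ with haMdef
  have haM0 : aM ≠ 0 := (map_ne_zero _).mpr ha₀
  set aU : (M : Type u)ˣ := Units.mk0 aM haM0 with haUdef
  have hνa₀ : ν aU ≠ 0 := by
    intro h
    apply hva₀
    simpa [ν] using congrArg Multiplicative.ofAdd h
  set c : ℕ := (ν aU).natAbs with hcdef
  have hc : 0 < c := Int.natAbs_pos.mpr hνa₀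
  -- the unit `u := σ x / x` of `M`
  have hσx0 : σ' x ≠ 0 := (map_ne_zero σ').mpr hx0
  set xM : M := ⟨x, hxM⟩ with hxMdef
  set sxM : M := ⟨σ' x, hσxM⟩ with hsxMdef
  have hxM0 : xM ≠ 0 := fun h => hx0 (congrArg Subtype.val h)
  have hsxM0 : sxM ≠ 0 := fun h => hσx0 (congrArg Subtype.val h)
  set u : (M : Type u)ˣ := Units.mk0 sxM hsxM0 / Units.mk0 xM hxM0 with hudef
  have hdiv : ∀ N : ℕ, 0 < N → ∃ b : (M : Type u)ˣ, b ^ N = u := by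
    intro N hN
    have hn : 0 < N * c := Nat.mul_pos hN hc
    obtain ⟨m, hm⟩ := exists_int_forall_sigma_eq_rel M σ' hcomm hn
    -- Step (2): `a₀ ∈ K` is fixed by `σ`, which pins down `m` modulo `N`
    set aΩ : AlgebraicClosure K := algebraMap K (AlgebraicClosure K) a₀ with haΩdef
    have haΩM : aΩ ∈ M := M.algebraMap_mem _
    have haΩ0 : aΩ ≠ 0 := by
      rw [haΩdef, map_ne_zero]
      exact ha₀
    obtain ⟨β, hβM, hβ0, hσa⟩ := hm aΩ haΩM haΩ0
    rw [haΩdef, AlgEquiv.commutes] at hσa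
    -- as units of `M`: `aU = βU ^ n * aU ^ m`
    set βM : M := ⟨β, hβM⟩ with hβMdef
    have hβM0 : βM ≠ 0 := fun h => hβ0 (congrArg Subtype.val h)
    set βU : (M : Type u)ˣ := Units.mk0 βM hβM0 with hβUdef
    have hUeq : aU = βU ^ (N * c) * aU ^ m := by
      apply Units.ext
      apply (algebraMap M (AlgebraicClosure K)).injective
      rw [Units.val_mul, Units.val_pow_eq_pow_val, Units.val_zpow_eq_zpow_val, map_mul, map_pow,
        map_zpow₀]
      exact hσa
    -- apply `ν`
    have hνeq : ν aU = (N * c : ℕ) * ν βU + m * ν aU := by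
      have := congrArg ν hUeq
      rw [hνmul, hνpow, hνzpow] at this
      exact_mod_cast this
    -- solve for `m`: `m = 1 + N * t`
    have hm1 : ∃ t : ℤ, m = 1 + N * t := by
      have hsc : ν aU = c ∨ ν aU = -c := by
        rcases Int.natAbs_eq (ν aU) with h | h
        · left; rw [← hcdef] at h; exact h
        · right; rw [← hcdef] at h; exact h
      have hc0 : (c : ℤ) ≠ 0 := by exact_mod_cast hc.ne'
      push_cast at hνeq
      rcases hsc with h | h
      · refine ⟨-ν βU, ?_⟩
        rw [h] at hνeq
        have : (c : ℤ) * (1 - m - N * ν βU) = 0 := by linear_combination hνeq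
        rcases mul_eq_zero.mp this with h1 | h1
        · exact absurd h1 hc0
        · linarith
      · refine ⟨ν βU, ?_⟩
        rw [h] at hνeq
        have : (c : ℤ) * (m - 1 - N * ν βU) = 0 := by linear_combination hνeq
        rcases mul_eq_zero.mp this with h1 | h1
        · exact absurd h1 hc0
        · linarith
    obtain ⟨t, ht⟩ := hm1
    -- Step (1) for `a = x`
    obtain ⟨β', hβ'M, hβ'0, hσxeq⟩ := hm x hxM hx0
    have hb0 : (⟨β' ^ c * x ^ t, mul_mem (pow_mem hβ'M _) (zpow_mem hxM t)⟩ : M) ≠ 0 := by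
      intro h
      have := congrArg Subtype.val h
      exact mul_ne_zero (pow_ne_zero _ hβ'0) (zpow_ne_zero _ hx0) this
    refine ⟨Units.mk0 _ hb0, ?_⟩
    apply Units.ext
    apply Subtype.ext
    change (β' ^ c * x ^ t) ^ N = σ' x / x
    rw [hσxeq, ht, eq_div_iff hx0, mul_pow, ← pow_mul, mul_comm c N, ← zpow_natCast (x ^ t),
      ← zpow_mul]
    rw [show x ^ (1 + (N : ℤ) * t) = x * x ^ (t * (N : ℤ)) by
      rw [← zpow_one_add₀ hx0]; ring_nf]
    ring
  -- `u` has finite order `k`: `σ x ^ k = x ^ k`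
  obtain ⟨k, hk, hku⟩ := (hD x u hdiv).exists_pow_eq_one
  refine ⟨k, hk, ?_⟩
  have := congrArg (fun w : (M : Type u)ˣ => ((w : M) : AlgebraicClosure K)) hku
  simp only [hudef, div_pow, Units.val_div_eq_div_val, Units.val_pow_eq_pow_val, Units.val_mk0,
    Units.val_one] at this
  have hval : (((sxM ^ k / xM ^ k : M)) : AlgebraicClosure K) = σ' x ^ k / x ^ k := rfl
  rw [hval] at this
  simpa [div_eq_one_iff_eq (pow_ne_zero k hx0)] using this

/-- **Relative slimness engine, subgroup form**: with `U = Gal(K̄/E)` viewed in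
`Field.absoluteGaloisGroup K`, the centraliser `Z_{G_K}(U)` is trivial under the hypotheses of
`AlgEquiv.eq_one_of_commute_fixingSubgroup_of_divisible_isOfFinOrder` (the shape of [AbsAnab]
Thm 1.1.1 (ii) for `U` an open subgroup of a decomposition group).
[cite: MochizukiAbsAnab2004, Thm 1.1.1 (ii) p.6] -/
theorem centralizer_fixingSubgroup_eq_bot_of_divisible_isOfFinOrder {K : Type u} [Field K]
    [CharZero K] (a₀ : K) (ha₀ : a₀ ≠ 0) (E : IntermediateField K (AlgebraicClosure K))
    (hv : ∀ x : AlgebraicClosure K,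
      ∃ v : ((E ⊔ K⟮x⟯ : IntermediateField K (AlgebraicClosure K)) : Type u)ˣ →* Multiplicative ℤ,
        v (Units.mk0 (algebraMap K (E ⊔ K⟮x⟯ : IntermediateField K (AlgebraicClosure K)) a₀)
          ((map_ne_zero _).mpr ha₀)) ≠ 1)
    (hD : ∀ x : AlgebraicClosure K,
      ∀ u : ((E ⊔ K⟮x⟯ : IntermediateField K (AlgebraicClosure K)) : Type u)ˣ,
        (∀ N : ℕ, 0 < N →
          ∃ b : ((E ⊔ K⟮x⟯ : IntermediateField K (AlgebraicClosure K)) : Type u)ˣ, b ^ N = u) →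
        IsOfFinOrder u) :
    Subgroup.centralizer
        ((E.fixingSubgroup.comap (absoluteGaloisGroup.toAlgEquiv K).toMonoidHom :
          Subgroup (absoluteGaloisGroup K)) : Set (absoluteGaloisGroup K)) = ⊥ := by
  rw [eq_bot_iff]
  intro g hg
  rw [Subgroup.mem_centralizer_iff] at hg
  rw [Subgroup.mem_bot]
  apply (absoluteGaloisGroup.toAlgEquiv K).injective
  rw [map_one]
  refine AlgEquiv.eq_one_of_commute_fixingSubgroup_of_divisible_isOfFinOrder a₀ ha₀ E _
    (fun τ hτ y => ?_) hv hD
  have hτU : (absoluteGaloisGroup.toAlgEquiv K).symm τ ∈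
      (E.fixingSubgroup.comap (absoluteGaloisGroup.toAlgEquiv K).toMonoidHom :
        Subgroup (absoluteGaloisGroup K)) := by
    simpa [Subgroup.mem_comap] using hτ
  have h := hg _ hτU
  have h' := congrArg (fun g' => absoluteGaloisGroup.toAlgEquiv K g' y) h
  simpa [AlgEquiv.mul_apply] using h'

end Literature.AnabelianGeometry.AbsoluteAnabelian
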